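import Summits.CriticalPhenomena.CardyFormulaZ2.Theorems.CardyIKTransportIKMixedBoxCrossingDefs2
import Summits.CriticalPhenomena.CardyFormulaZ2.Theorems.CardyIKTransportIKLinearTransportStubConditionalRSWFlips
import Summits.CriticalPhenomena.CardyFormulaZ2.Theorems.CardyIKTransportIKLinearTransportStubConditionalRSWCells
import Summits.CriticalPhenomena.CardyFormulaZ2.Theorems.CardyIKTransportIKLinearTransportStubConditionalRSWFiniteEnergy

/-!
# Stub `stub_finiteEnergy` (line `paired-mirror-exploration`, crux `IKMixedBoxCrossing`, stmt-CriticalPhenomena-5911)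

Support file (`--supports stmt-CriticalPhenomena-5911`): FINITE ENERGY of the column-mixed IK gauge with the
SHARP constant.  For every column pattern `S`, every cell `v` and every measurable event `E` of observables
not reading `v` (`E ∈ determinedOn {u | u ≠ v}`):
`(9/25) · μIK(obs S ⁻¹' E) ≤ μIK(obs S ⁻¹' E ∩ {v black})`.

Proof.  The tree's single-cell flips (`exists_cellFlip`, file `…StubConditionalRSWCells`: the four plaquettes
around `v` in both plaquette fields, plus free sign bits on the axes / at the origin) toggle the colour of `v`
and of no other cell, fix the diagonal coins, and change `μIK` by at most `K⁴` where `K` is the one-plaquette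
factor.  The tree's generator `faceFlip_spec` has the crude factor `min(q, 1-q)⁻¹`; here we supply the SHARP
one-site factor `(1-q)/q` for a Bernoulli field of density `q ≤ 1/2` (`sitePercolation_real_flip_le`: split at
the site, `q² ≤ (1-q)²`), whence `K = (1-q)/q = 2/√3` for `q = 2√3 - 3` and `K⁴ = 16/9` (`factor_pow_four`).
Since `E` does not read `v` and the coins are fixed, `obs S ⁻¹' E` is invariant under the flip
(`crsw_obs_mem_iff_of_cellFlip`), so `μ(obs⁻¹E ∩ {v white}) ≤ (16/9) μ(obs⁻¹E ∩ {v black})` and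
`μ(obs⁻¹E) ≤ (25/9) μ(obs⁻¹E ∩ {v black})`.
-/

noncomputable section

namespace Summit.CriticalPhenomena.CardyFormulaZ2.Cruxes.IKMixedBoxCrossing.PairedMirrorExploration

open scoped ENNReal symmDiff
open MeasureTheory
open Literature.Probability.Percolation Literature.Probability.LatticeModels
open Summit.CriticalPhenomena.CardyFormulaZ2.Theorems.IKLinearTransport.PinnedDiagramExchange
open Summit.CriticalPhenomena.CardyFormulaZ2.Theorems.IKMixedBoxCrossing.Negative
  (pDef coe_pDef sqrt3_bounds)

namespace FiniteEnergyStub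

/-! ## The sharp one-site flip bound for a Bernoulli field of density `q ≤ 1/2` -/

/-- SHARP ONE-SITE FLIP BOUND: `q · P_q(flip_x⁻¹ U) ≤ (1 - q) · P_q(U)` when `q ≤ 1/2`. [folklore] -/
theorem sitePercolation_real_flip_le {V : Type*} (q : unitInterval) (hq : (q : ℝ) ≤ 1 / 2) (x : V)
    {U : Set (Set V)} (hU : MeasurableSet U) :
    (q : ℝ) * (sitePercolation V q).real ((fun S : Set V => S ∆ {x}) ⁻¹' U) ≤
      (1 - q) * (sitePercolation V q).real U := by
  have hfU : MeasurableSet ((fun S : Set V => S ∆ {x}) ⁻¹' U) := crsw_measurable_symmDiff_right {x} hU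
  have hins : (fun S : Set V => insert x S) ⁻¹' ((fun S : Set V => S ∆ {x}) ⁻¹' U) =
      (fun S : Set V => S \ {x}) ⁻¹' U := by
    ext S
    simp only [Set.mem_preimage]
    have : insert x S ∆ {x} = S \ {x} := by
      ext v; by_cases hv : v = x <;> simp [Set.mem_symmDiff, hv]
    rw [this]
  have hdel : (fun S : Set V => S \ {x}) ⁻¹' ((fun S : Set V => S ∆ {x}) ⁻¹' U) =
      (fun S : Set V => insert x S) ⁻¹' U := by
    ext S
    simp only [Set.mem_preimage]
    have : (S \ {x}) ∆ {x} = insert x S := by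
      ext v; by_cases hv : v = x <;> simp [hv]
    rw [this]
  rw [crsw_sitePercolation_real_split q x hfU, crsw_sitePercolation_real_split q x hU, hins, hdel]
  set A := (sitePercolation V q).real ((fun S : Set V => insert x S) ⁻¹' U)
  set B := (sitePercolation V q).real ((fun S : Set V => S \ {x}) ⁻¹' U)
  have hB : 0 ≤ B := measureReal_nonneg
  have hkey : 0 ≤ B * (1 - 2 * (q : ℝ)) := mul_nonneg hB (by linarith)
  nlinarith [hkey]

/-- SHARP ONE-SITE FLIP BOUND, measure form: `P_q ∘ flip_x⁻¹ ≤ ((1-q)/q) · P_q` when `0 < q ≤ 1/2`. [folklore] -/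
theorem sitePercolation_map_flip_le {V : Type*} (q : unitInterval) (hq0 : 0 < (q : ℝ))
    (hq : (q : ℝ) ≤ 1 / 2) (x : V) :
    (sitePercolation V q).map (fun S : Set V => S ∆ {x}) ≤
      ENNReal.ofReal ((1 - (q : ℝ)) / q) • sitePercolation V q := by
  refine Measure.le_iff.2 fun U hU => ?_
  have key : (sitePercolation V q).real ((fun S : Set V => S ∆ {x}) ⁻¹' U) ≤
      (1 - (q : ℝ)) / q * (sitePercolation V q).real U := by
    rw [div_mul_eq_mul_div, le_div_iff₀ hq0, mul_comm]
    exact sitePercolation_real_flip_le q hq x hU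
  have hK : 0 ≤ (1 - (q : ℝ)) / q := div_nonneg (sub_nonneg.2 q.2.2) q.2.1
  have e1 : sitePercolation V q ((fun S : Set V => S ∆ {x}) ⁻¹' U) =
      ENNReal.ofReal ((sitePercolation V q).real ((fun S : Set V => S ∆ {x}) ⁻¹' U)) :=
    (ofReal_measureReal (measure_ne_top _ _)).symm
  have e2 : sitePercolation V q U = ENNReal.ofReal ((sitePercolation V q).real U) :=
    (ofReal_measureReal (measure_ne_top _ _)).symm
  rw [Measure.map_apply (crsw_measurable_symmDiff_right {x}) hU, Measure.smul_apply, smul_eq_mul, e1, e2,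
    ← ENNReal.ofReal_mul hK]
  exact ENNReal.ofReal_le_ofReal key

/-! ## The plaquette density `q = 2√3 - 3` and the factor `(1-q)/q = 2/√3` -/

/-- `0 < q ≤ 1/2` for the plaquette density `q = 2√3 - 3`. [folklore] -/
theorem pDef_pos_le_half : 0 < (pDef : ℝ) ∧ (pDef : ℝ) ≤ 1 / 2 := by
  have ⟨h1, h2⟩ := sqrt3_bounds
  rw [coe_pDef]
  constructor <;> linarith

/-- The one-plaquette factor to the fourth power: `((1-q)/q)⁴ = (2/√3)⁴ = 16/9`. [folklore] -/
theorem factor_pow_four : ((1 - (pDef : ℝ)) / pDef) ^ 4 = 16 / 9 := by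
  have hq0 : (pDef : ℝ) ≠ 0 := pDef_pos_le_half.1.ne'
  have h3 : Real.sqrt 3 ^ 2 = 3 := Real.sq_sqrt (by norm_num)
  have hK : (1 - (pDef : ℝ)) / pDef = 2 * Real.sqrt 3 / 3 := by
    rw [div_eq_div_iff hq0 (by norm_num), coe_pDef]
    nlinarith [h3]
  rw [hK, div_pow, mul_pow, show Real.sqrt 3 ^ 4 = (Real.sqrt 3 ^ 2) ^ 2 by ring, h3]
  norm_num

/-- The fourth power of the one-plaquette factor in `ℝ≥0∞` is `16/9`. [folklore] -/
theorem ofReal_factor_pow_four :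
    ENNReal.ofReal ((1 - (pDef : ℝ)) / pDef) ^ 4 = ENNReal.ofReal (16 / 9) := by
  rw [← ENNReal.ofReal_pow (div_nonneg (sub_nonneg.2 pDef.2.2) pDef.2.1), factor_pow_four]

/-! ## The sharp plaquette flip of the gauge -/

/-- SHARP PLAQUETTE FLIP at the face `g` (both plaquette fields): measurable, factor `(1-q)/q`, coins fixed,
toggles the cells whose anchoring rectangle contains `g` (toggle bookkeeping from the tree's `faceFlip_spec`). [folklore] -/
theorem faceFlip_sharp (g : Site 2) :
    Measurable (fun ω : Ω => ((ω.1, ω.2.1, ω.2.2.1 ∆ {g}, ω.2.2.2.1 ∆ {g}, ω.2.2.2.2) : Ω)) ∧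
    μIK.map (fun ω : Ω => ((ω.1, ω.2.1, ω.2.2.1 ∆ {g}, ω.2.2.2.1 ∆ {g}, ω.2.2.2.2) : Ω)) ≤
      ENNReal.ofReal ((1 - (pDef : ℝ)) / pDef) • μIK ∧
    (∀ ω : Ω, ((ω.1, ω.2.1, ω.2.2.1 ∆ {g}, ω.2.2.2.1 ∆ {g}, ω.2.2.2.2) : Ω).2.2.2.2 = ω.2.2.2.2) ∧
    ∀ (S : Set ℤ) (ω : Ω) (v : Site 2),
      v ∈ blackSet S ((ω.1, ω.2.1, ω.2.2.1 ∆ {g}, ω.2.2.2.1 ∆ {g}, ω.2.2.2.2) : Ω) ↔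
        Xor (v ∈ blackSet S ω)
          ((min 0 (v 0) ≤ g 0 ∧ g 0 < max 0 (v 0)) ∧ (min 0 (v 1) ≤ g 1 ∧ g 1 < max 0 (v 1))) := by
  obtain ⟨hm, -, hc, ht⟩ := faceFlip_spec g
  refine ⟨hm, ?_, hc, ht⟩
  have h45 := crsw_map_prodMap_le (μ := sitePercolation (Site 2) half) (ν := sitePercolation (Site 2) half)
    (crsw_measurable_symmDiff_right {g}) measurable_id
    (crsw_map_le_one_smul_of_eq (crsw_sitePercolation_half_map_symmDiff (V := Site 2) {g}))
    (crsw_map_le_one_smul_of_eq Measure.map_id)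
  have h345 := crsw_map_prodMap_le (crsw_measurable_symmDiff_right {g})
    ((crsw_measurable_symmDiff_right {g}).prodMap measurable_id)
    (sitePercolation_map_flip_le (V := Site 2) pDef pDef_pos_le_half.1 pDef_pos_le_half.2 g) h45
  have h2345 := crsw_map_prodMap_le (μ := sitePercolation ℤ half) measurable_id
    ((crsw_measurable_symmDiff_right {g}).prodMap ((crsw_measurable_symmDiff_right {g}).prodMap measurable_id))
    (crsw_map_le_one_smul_of_eq Measure.map_id) h345
  have h := crsw_map_prodMap_le (μ := sitePercolation ℤ half) measurable_id
    (measurable_id.prodMap ((crsw_measurable_symmDiff_right {g}).prodMap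
      ((crsw_measurable_symmDiff_right {g}).prodMap measurable_id)))
    (crsw_map_le_one_smul_of_eq Measure.map_id) h2345
  simp only [one_mul, mul_one] at h
  exact h

/-- SHARP SINGLE-CELL FLIP: for every cell `c` a measurable flip of the gauge bits with factor `16/9`, fixing
the coins, toggling the colour of `c` and of no other cell, for every column pattern `S`. [folklore] -/
theorem exists_cellFlip_sharp (c : Site 2) :
    ∃ Φ : Ω → Ω, Measurable Φ ∧ μIK.map Φ ≤ ENNReal.ofReal (16 / 9) • μIK ∧
      (∀ ω, (Φ ω).2.2.2.2 = ω.2.2.2.2) ∧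
      ∀ (S : Set ℤ) (ω : Ω) (v : Site 2), v ∈ blackSet S (Φ ω) ↔ Xor (v ∈ blackSet S ω) (v = c) := by
  rw [← ofReal_factor_pow_four]
  exact exists_cellFlip rowFlip_spec colFlip_spec faceFlip_sharp c

end FiniteEnergyStub

open FiniteEnergyStub in
/-- **Stub `stub_finiteEnergy`** · FINITE ENERGY of the column-mixed IK gauge, sharp constant: for every
column pattern `S`, cell `v` and measurable event `E` of observables not reading `v`,
`(9/25) · μIK(obs S ⁻¹' E) ≤ μIK(obs S ⁻¹' E ∩ {v black})`. [folklore] -/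
theorem stub_finiteEnergy : FiniteEnergy := by
  intro S v E _ hdet
  haveI : IsProbabilityMeasure μIK := CouplingToLimits.isProbabilityMeasure_μIK
  obtain ⟨Φ, hΦm, hΦb, hΦc, hΦt⟩ := exists_cellFlip_sharp v
  set G : Set Ω := obs S ⁻¹' E with hG
  set Bl : Set Ω := {ω | v ∈ blackSet S ω} with hBl
  have hBlm : MeasurableSet Bl := measurableSet_setOf.2 (CouplingToLimits.measurable_mem_blackSet S v)
  have hv : v ∉ {u : Site 2 | u ≠ v} := fun h => h rfl
  have hsub : G \ Bl ⊆ Φ ⁻¹' (G ∩ Bl) := by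
    rintro ω ⟨hωG, hωW⟩
    refine ⟨(crsw_obs_mem_iff_of_cellFlip hdet hv hΦc hΦt S ω).2 hωG, ?_⟩
    show v ∈ blackSet S (Φ ω)
    rw [hΦt, xor_def]
    exact Or.inr ⟨rfl, hωW⟩
  have h1 : μIK (G \ Bl) ≤ ENNReal.ofReal (16 / 9) * μIK (G ∩ Bl) :=
    (measure_mono hsub).trans (crsw_preimage_le_of_map_le hΦm hΦb _)
  have h2 : μIK.real (G \ Bl) ≤ 16 / 9 * μIK.real (G ∩ Bl) := by
    rw [measureReal_def, measureReal_def, ← ENNReal.toReal_ofReal (show (0 : ℝ) ≤ 16 / 9 by norm_num),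
      ← ENNReal.toReal_mul]
    exact ENNReal.toReal_mono (ENNReal.mul_ne_top ENNReal.ofReal_ne_top (measure_ne_top _ _)) h1
  have h3 : μIK.real (G ∩ Bl) + μIK.real (G \ Bl) = μIK.real G := measureReal_inter_add_sdiff hBlm
  linarith

end Summit.CriticalPhenomena.CardyFormulaZ2.Cruxes.IKMixedBoxCrossing.PairedMirrorExploration

end
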